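import Mathlib
import Summits.Ventures.PercRepro2.K5HyperCoeffs
import Summits.Ventures.PercRepro2.K5HyperTheorem
import Summits.Ventures.PercRepro2.K5HyperCertM1
import Summits.Ventures.PercRepro2.K5HyperCertM2
import Summits.Ventures.PercRepro2.K5HyperCertM3
import Summits.Ventures.PercRepro2.K5HyperCertM4
import Summits.Ventures.PercRepro2.K5HyperCertM5
import Summits.Ventures.PercRepro2.K5HyperCertTvTA
import Summits.Ventures.PercRepro2.K5HyperCertTvTB
import Summits.Ventures.PercRepro2.K5HyperCertTvTC

/-!
# THE 40 STAR COMPARISONS OF mine-1 §23.1 AT EVERY `K₅` PROFILE, IN THE KERNEL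
(blind cell PercRepro2, typer-1 g10)

The kernel certificates `K5HyperCertM*.lean` / `K5HyperCertTvT*.lean` collected over all triangles
`T = {a, b, c}` of marks (`certTvT`, `certM`), through the digit bridge `K5HyperCoeffs.lean` and the
dictionary `K5HyperTheorem.lean`:

* **`TvT_nonneg`** / **`TvT_nonneg_real`**: for every triangle, `cNegTvT a b c k ≤ cPosTvT a b c k`, i.e.
  `N(H + T(1)) ≤ N(H + △(1,1,1))` as profile sums of `KII` — `TvT-(ii) ≥ 0` at every `K₅` profile;
* **`M_nonneg`** / **`M_nonneg_real`**: for every triangle and every pair `e = {x, y} ⊆ T`,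
  `cNegM (triMask a b c) (pairMask x y) k ≤ cPosM …`, i.e. `N(H + T(1)) ≤ N(H + T(1) + e(1))` —
  `M(H, T, e) ≥ 0` at every `K₅` profile.
-/

namespace Summit.Ventures.PercRepro2

namespace K5

/-- **The `TvT` certificate of every triangle of marks.** -/
theorem certTvT (a b c : ℕ) (hab : a < b) (hbc : b < c) (hc : c < 5) :
    CertLE (kNegTvT a b c) (kPosTvT a b c) := by
  interval_cases c <;> interval_cases b <;> interval_cases a
  · exact cert_TvT_012
  · exact cert_TvT_013
  · exact cert_TvT_023
  · exact cert_TvT_123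
  · exact cert_TvT_014
  · exact cert_TvT_024
  · exact cert_TvT_124
  · exact cert_TvT_034
  · exact cert_TvT_134
  · exact cert_TvT_234

/-- **The `M` certificate of every triangle of marks and every pair of it.** -/
theorem certM (a b c x y : ℕ) (hab : a < b) (hbc : b < c) (hc : c < 5)
    (hxy : (x = a ∧ y = b) ∨ (x = a ∧ y = c) ∨ (x = b ∧ y = c)) :
    CertLE (kNegM (triMask a b c) (pairMask x y)) (kPosM (triMask a b c) (pairMask x y)) := by
  interval_cases c <;> interval_cases b <;> interval_cases a <;>
    rcases hxy with ⟨rfl, rfl⟩ | ⟨rfl, rfl⟩ | ⟨rfl, rfl⟩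
  · exact cert_M_012_01
  · exact cert_M_012_02
  · exact cert_M_012_12
  · exact cert_M_013_01
  · exact cert_M_013_03
  · exact cert_M_013_13
  · exact cert_M_023_02
  · exact cert_M_023_03
  · exact cert_M_023_23
  · exact cert_M_123_12
  · exact cert_M_123_13
  · exact cert_M_123_23
  · exact cert_M_014_01
  · exact cert_M_014_04
  · exact cert_M_014_14
  · exact cert_M_024_02
  · exact cert_M_024_04
  · exact cert_M_024_24
  · exact cert_M_124_12
  · exact cert_M_124_14
  · exact cert_M_124_24
  · exact cert_M_034_03
  · exact cert_M_034_04
  · exact cert_M_034_34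
  · exact cert_M_134_13
  · exact cert_M_134_14
  · exact cert_M_134_34
  · exact cert_M_234_23
  · exact cert_M_234_24
  · exact cert_M_234_34

/-- **`TvT-(ii) ≥ 0` on every triangle of marks**, at every profile (coefficients). -/
theorem TvT_nonneg (a b c : ℕ) (hab : a < b) (hbc : b < c) (hc : c < 5) (k : Fin 10 → Fin 4) :
    cNegTvT a b c k ≤ cPosTvT a b c k :=
  cNegTvT_le_cPosTvT a b c (certTvT a b c hab hbc hc) k

/-- **`M(H, T, e) ≥ 0` on every triangle of marks and every pair of it**, at every profile
(coefficients). -/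
theorem M_nonneg (a b c x y : ℕ) (hab : a < b) (hbc : b < c) (hc : c < 5)
    (hxy : (x = a ∧ y = b) ∨ (x = a ∧ y = c) ∨ (x = b ∧ y = c)) (k : Fin 10 → Fin 4) :
    cNegM (triMask a b c) (pairMask x y) k ≤ cPosM (triMask a b c) (pairMask x y) k :=
  cNegM_le_cPosM _ _ (certM a b c x y hab hbc hc hxy) k

variable {R : Type*} [Field R] [LinearOrder R] [IsStrictOrderedRing R]

/-- **`TvT-(ii) ≥ 0`: `N(H + T(1)) ≤ N(H + △(1,1,1))`** as profile sums of `KII`, every triangle, every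
profile. -/
theorem TvT_nonneg_real (a b c : ℕ) (hab : a < b) (hbc : b < c) (hc : c < 5) (k : Fin 10 → Fin 4) :
    NT1 (R := R) (triMask a b c) k ≤ NE3 (R := R) (pairMask a b) (pairMask a c) (pairMask b c) k :=
  TvT_real a b c (certTvT a b c hab hbc hc) k

/-- **`M(H, T, e) ≥ 0`: `N(H + T(1)) ≤ N(H + T(1) + e(1))`** as profile sums of `KII`, every triangle,
every pair of it, every profile. -/
theorem M_nonneg_real (a b c x y : ℕ) (hab : a < b) (hbc : b < c) (hc : c < 5)
    (hxy : (x = a ∧ y = b) ∨ (x = a ∧ y = c) ∨ (x = b ∧ y = c)) (k : Fin 10 → Fin 4) :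
    NT1 (R := R) (triMask a b c) k ≤ NT1e1 (R := R) (triMask a b c) (pairMask x y) k :=
  M_real _ _ (certM a b c x y hab hbc hc hxy) k

end K5

end Summit.Ventures.PercRepro2
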